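import Mathlib
import HarnessLib
import Summits.NavierStokesRegularity.NavierStokesRegularity.Theorems.PoloidalWindowDoorLrcModEntireTwistingTHPlaneOscillationEnvelope

/-!
# Item `LrcModEntire` (stmt-NavierStokesRegularity-20428), CLASS road to `stub_twistingTHGerm` — the plane-oscillation law in
# θ-CURRENCY, valid for EVERY class profile (no (TH), no poloidality): `∂ₜD + ½∂_z(S·D) − ∂_zzD ≤ −(∂_zp(x⁺) − ∂_zp(x⁻))`

Cell ns-regularity-ideate, LEAD ns-poloidal-K2-p3 g13 (`--supports stmt-NavierStokesRegularity-20428`; companion of ns-k2-port-2's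
`…TwistingTHPlaneOscillation` / `…Envelope` (the (OSC) law for the Clebsch weight `W = (1−μ)v₂`, which needs (TH)) and of the LEAD's memo
OSC-LIOUVILLE-g13 §5 (W2), crux dir).

THE POINT.  For ANY profile `v` of the route's Type-I class (rate, continuity, Oseen-mild, div-free — (TH) and poloidality are NOT used) and any
slice `t < 0`, let `x⁺`, `x⁻` be a local maximum / minimum of the vertical velocity `θ = v₂(t,·)` RESTRICTED TO ONE HORIZONTAL PLANE `{y₂ = c}`.
With the intrinsic vertical residual `f₂(t,x) := ∂ₜv₂ + Dv₂(x)·v(t,x) − Δv₂` (`= −∂₂p` on classical windows: `…VelocityGradientLaw.curl_residual_eq_zero`,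
`…SlopeFunctionPressure.material_vert_eq_residual`) one has, by B2-type calculus only (`∇ₕθ = 0`, `Δₕθ ≤ 0` at `x⁺`):
* `theta_planeMax_le` / `theta_planeMin_ge` — `[∂ₜθ + θ·∂₂θ − ∂₂∂₂θ](x⁺) ≤ f₂(x⁺)`, `[∂ₜθ + θ·∂₂θ − ∂₂∂₂θ](x⁻) ≥ f₂(x⁻)`;
* `theta_twoPoint` — their difference;
* `theta_osc_sub_sup` — the ENVELOPE (touching) step, exactly as in `…Envelope.osc_sub_sup` but for `θ` itself: with upper/lower envelopes
  `M, m : ℝ → ℝ → ℝ` through the height, `[∂ₜM + θ(x⁺)∂_zM − ∂_zzM](t,c) − [∂ₜm + θ(x⁻)∂_zm − ∂_zzm](t,c) ≤ f₂(t,x⁺) − f₂(t,x⁻)`;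
* `theta_osc_divergence_form` — the algebra: with `D := M − m` (plane oscillation of `v₂`) and `S := M + m`,
  `(∂ₜM − ∂ₜm) + ½(S·D)′ − D″ ≤ f₂(x⁺) − f₂(x⁻)` (here `θ(x±) = M, m` at `(t,c)`).

READING (memo §5 (W2)).  `D ≤ 2N(−t)^{−1/2}` is BOUNDED in similarity variables (unlike the `W`-oscillation of the (TH) road), so by the memo's
Theorem (L) a SIGN `∂_zp(t,x⁺) ≥ ∂_zp(t,x⁻)` on all planes (equivalently `f₂(x⁺) ≤ f₂(x⁻)`) would give `D ≡ 0`, i.e. `v₂` plane-wise constant,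
hence `v ≡ 0` — in ANY sub-class where such a sign is available.  No sign is claimed here.

WHAT THIS IS NOT: not a claim about Navier–Stokes regularity and not the stub — calculus at plane extrema of `v₂` for class profiles
(bears_on LADDER-NS N0, item 20428 / crux 19708; both OPEN).
-/

noncomputable section

-- the summit and its single sub-problem share the name (CONVENTIONS §1), as in every Theorems file
set_option linter.dupNamespace false

namespace Summit.NavierStokesRegularity.NavierStokesRegularity.Theorems.PoloidalWindowDoorLrcModEntirePlaneOscillationTheta

open MeasureTheory Set Function Filter Topology Metric InnerProductSpace
open scoped RealInnerProductSpace InnerProductSpace Laplacian ContDiff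
open Literature.Analysis Literature.Analysis.FluidPDE
open Summit.NavierStokesRegularity.NavierStokesRegularity.Theorems.LocalSineTubeDoorProfileAlignedWindowRigidityAncient
open Summit.NavierStokesRegularity.NavierStokesRegularity.Theorems.PoloidalWindowDoorPoloidalWindowRigidityWindow
open Summit.NavierStokesRegularity.NavierStokesRegularity.Theorems.PoloidalWindowDoorPoloidalWindowRigiditySlopeFunctionPressure
open Summit.NavierStokesRegularity.NavierStokesRegularity.Theorems.PoloidalWindowDoorLrcModEntireTwistingTHPlaneOscillation
open Summit.NavierStokesRegularity.NavierStokesRegularity.Theorems.PoloidalWindowDoorLrcModEntireTwistingTHPlaneOscillationEnvelope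

section Class

variable {C : ℝ} {v : ℝ → EuclideanSpace ℝ (Fin 3) → EuclideanSpace ℝ (Fin 3)}
variable (hrate : HasTypeITimeDecay C v) (hcont : ContinuousOn (uncurry v) (Iio (0 : ℝ) ×ˢ univ))
  (hmild : ∀ s t : ℝ, s < t → t < 0 → ∀ x,
    v t x = UnboundedOperators.heatExtension (v s) (t - s) x - oseenDuhamel 1 s v v t x)
  (hdiv : ∀ t < 0, VectorCalculus.IsDivFree (v t))

include hrate hcont hmild hdiv

/-- The slice `θ = v₂(t,·)` is `C²`. -/
theorem contDiff_two_theta {t : ℝ} (ht : t < 0) : ContDiff ℝ 2 (fun y : EuclideanSpace ℝ (Fin 3) => v t y 2) :=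
  (contDiff_vert_slice hrate hcont hmild hdiv ht).of_le (by norm_cast)

/-- **At a plane-restricted local MAXIMUM `x` of `θ = v₂(t,·)`:** `∂ₜθ + θ·∂₂θ − ∂₂∂₂θ ≤ f₂` at `(t,x)`, where
`f₂ = ∂ₜθ + Dθ·v − Δθ` is the intrinsic vertical residual (`= −∂₂p` classically).  B2 only: `Dθ(x)·v = v₂∂₂θ` and `Δθ ≤ ∂₂∂₂θ`. -/
theorem theta_planeMax_le {t : ℝ} (ht : t < 0) {x : EuclideanSpace ℝ (Fin 3)}
    (hmax : IsLocalMaxOn (fun y : EuclideanSpace ℝ (Fin 3) => v t y 2) {y : EuclideanSpace ℝ (Fin 3) | y 2 = x 2} x) :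
    deriv (fun s => v s x 2) t + v t x 2 * fderiv ℝ (fun y => v t y 2) x (EuclideanSpace.single 2 1)
        - fderiv ℝ (fun y => fderiv ℝ (fun y => v t y 2) y (EuclideanSpace.single 2 1)) x (EuclideanSpace.single 2 1) ≤
      deriv (fun s => v s x 2) t + fderiv ℝ (fun y => v t y 2) x (v t x) - Δ (fun y => v t y 2) x := by
  have hθ2 := contDiff_two_theta hrate hcont hmild hdiv ht
  have hθd : Differentiable ℝ (fun y : EuclideanSpace ℝ (Fin 3) => v t y 2) := hθ2.differentiable (by norm_num)
  have h0 := fderiv_horiz_eq_zero_of_planeMax hθd hmax (b := 0) (by decide)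
  have h1 := fderiv_horiz_eq_zero_of_planeMax hθd hmax (b := 1) (by decide)
  have hconv := fderiv_apply_of_horiz_eq_zero h0 h1 (v t x)
  have hlap := laplacian_le_vert_of_planeMax hθ2 hmax
  rw [hconv]
  linarith

/-- **At a plane-restricted local MINIMUM `x` of `θ = v₂(t,·)`:** `f₂ ≤ ∂ₜθ + θ·∂₂θ − ∂₂∂₂θ` at `(t,x)`. -/
theorem theta_planeMin_ge {t : ℝ} (ht : t < 0) {x : EuclideanSpace ℝ (Fin 3)}
    (hmin : IsLocalMinOn (fun y : EuclideanSpace ℝ (Fin 3) => v t y 2) {y : EuclideanSpace ℝ (Fin 3) | y 2 = x 2} x) :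
    deriv (fun s => v s x 2) t + fderiv ℝ (fun y => v t y 2) x (v t x) - Δ (fun y => v t y 2) x ≤
      deriv (fun s => v s x 2) t + v t x 2 * fderiv ℝ (fun y => v t y 2) x (EuclideanSpace.single 2 1)
        - fderiv ℝ (fun y => fderiv ℝ (fun y => v t y 2) y (EuclideanSpace.single 2 1)) x (EuclideanSpace.single 2 1) := by
  have hθ2 := contDiff_two_theta hrate hcont hmild hdiv ht
  have hθd : Differentiable ℝ (fun y : EuclideanSpace ℝ (Fin 3) => v t y 2) := hθ2.differentiable (by norm_num)
  have h0 := fderiv_horiz_eq_zero_of_planeMin hθd hmin (b := 0) (by decide)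
  have h1 := fderiv_horiz_eq_zero_of_planeMin hθd hmin (b := 1) (by decide)
  have hconv := fderiv_apply_of_horiz_eq_zero h0 h1 (v t x)
  have hlap := vert_le_laplacian_of_planeMin hθ2 hmin
  rw [hconv]
  linarith

/-- **The two-point inequality for `θ = v₂`** (plane max `x⁺`, plane min `x⁻` of one slice; any class profile):
`[∂ₜθ + θ∂₂θ − ∂₂∂₂θ](x⁺) − [∂ₜθ + θ∂₂θ − ∂₂∂₂θ](x⁻) ≤ f₂(x⁺) − f₂(x⁻)`. -/
theorem theta_twoPoint {t : ℝ} (ht : t < 0) {xp xm : EuclideanSpace ℝ (Fin 3)}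
    (hmax : IsLocalMaxOn (fun y : EuclideanSpace ℝ (Fin 3) => v t y 2) {y : EuclideanSpace ℝ (Fin 3) | y 2 = xp 2} xp)
    (hmin : IsLocalMinOn (fun y : EuclideanSpace ℝ (Fin 3) => v t y 2) {y : EuclideanSpace ℝ (Fin 3) | y 2 = xm 2} xm) :
    (deriv (fun s => v s xp 2) t + v t xp 2 * fderiv ℝ (fun y => v t y 2) xp (EuclideanSpace.single 2 1)
        - fderiv ℝ (fun y => fderiv ℝ (fun y => v t y 2) y (EuclideanSpace.single 2 1)) xp (EuclideanSpace.single 2 1))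
      - (deriv (fun s => v s xm 2) t + v t xm 2 * fderiv ℝ (fun y => v t y 2) xm (EuclideanSpace.single 2 1)
        - fderiv ℝ (fun y => fderiv ℝ (fun y => v t y 2) y (EuclideanSpace.single 2 1)) xm (EuclideanSpace.single 2 1)) ≤
      (deriv (fun s => v s xp 2) t + fderiv ℝ (fun y => v t y 2) xp (v t xp) - Δ (fun y => v t y 2) xp)
        - (deriv (fun s => v s xm 2) t + fderiv ℝ (fun y => v t y 2) xm (v t xm) - Δ (fun y => v t y 2) xm) := by
  have hp := theta_planeMax_le hrate hcont hmild hdiv ht hmax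
  have hm := theta_planeMin_ge hrate hcont hmild hdiv ht hmin
  linarith

/-- **(SUB_θ) − (SUP_θ) after the ENVELOPE step.**  Let `x⁺, x⁻` lie on the plane `{y₂ = c}` of the slice `t < 0`, and let
`M, m : ℝ → ℝ → ℝ` (functions of `(time, height)`) satisfy `v₂(s,y) ≤ M(s,y₂)` for `(s,y)` near `(t,x⁺)` with equality at `(t,x⁺)` and
`m(s,y₂) ≤ v₂(s,y)` near `(t,x⁻)` with equality at `(t,x⁻)` (upper/lower envelopes through the height — e.g. the plane sup/inf when attained),
`s ↦ M(s,c)`, `s ↦ m(s,c)` differentiable at `t`, `M(t,·)`, `m(t,·)` differentiable near `c` with derivatives differentiable at `c`.  Then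
`[∂ₜM + v₂(t,x⁺)∂_zM − ∂_zzM](t,c) − [∂ₜm + v₂(t,x⁻)∂_zm − ∂_zzm](t,c) ≤ f₂(t,x⁺) − f₂(t,x⁻)`.  No (TH), no poloidality. -/
theorem theta_osc_sub_sup {t : ℝ} (ht : t < 0) {c : ℝ} {xp xm : EuclideanSpace ℝ (Fin 3)} (hxp : xp 2 = c) (hxm : xm 2 = c)
    {M m : ℝ → ℝ → ℝ}
    (hM : ∀ᶠ q in 𝓝 ((t, xp) : ℝ × EuclideanSpace ℝ (Fin 3)), v q.1 q.2 2 ≤ M q.1 (q.2 2))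
    (hMeq : v t xp 2 = M t c)
    (hm : ∀ᶠ q in 𝓝 ((t, xm) : ℝ × EuclideanSpace ℝ (Fin 3)), m q.1 (q.2 2) ≤ v q.1 q.2 2)
    (hmeq : v t xm 2 = m t c)
    (hMt : DifferentiableAt ℝ (fun s => M s c) t) (hmt : DifferentiableAt ℝ (fun s => m s c) t)
    (hM1 : ∀ᶠ z in 𝓝 c, DifferentiableAt ℝ (M t) z) (hm1 : ∀ᶠ z in 𝓝 c, DifferentiableAt ℝ (m t) z)
    (hM2 : DifferentiableAt ℝ (deriv (M t)) c) (hm2 : DifferentiableAt ℝ (deriv (m t)) c) :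
    (deriv (fun s => M s c) t + v t xp 2 * deriv (M t) c - deriv (deriv (M t)) c)
      - (deriv (fun s => m s c) t + v t xm 2 * deriv (m t) c - deriv (deriv (m t)) c) ≤
      (deriv (fun s => v s xp 2) t + fderiv ℝ (fun y => v t y 2) xp (v t xp) - Δ (fun y => v t y 2) xp)
        - (deriv (fun s => v s xm 2) t + fderiv ℝ (fun y => v t y 2) xm (v t xm) - Δ (fun y => v t y 2) xm) := by
  -- `θ(t,·)` and its regularity
  set Wt : EuclideanSpace ℝ (Fin 3) → ℝ := fun y => v t y 2 with hWt
  have hW2 : ContDiff ℝ 2 Wt := contDiff_two_theta hrate hcont hmild hdiv ht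
  have hWd : Differentiable ℝ Wt := hW2.differentiable (by norm_num)
  have hW1c : ContDiff ℝ 1 fun y => fderiv ℝ Wt y (EuclideanSpace.single 2 (1 : ℝ)) :=
    (hW2.fderiv_right (m := 1) le_rfl).clm_apply contDiff_const
  set e₂ : EuclideanSpace ℝ (Fin 3) := EuclideanSpace.single 2 (1 : ℝ) with he₂
  have hmax : IsLocalMaxOn Wt {y : EuclideanSpace ℝ (Fin 3) | y 2 = xp 2} xp := by
    have hc' : ContinuousAt (fun y : EuclideanSpace ℝ (Fin 3) => ((t, y) : ℝ × EuclideanSpace ℝ (Fin 3))) xp := by fun_prop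
    have h1 : ∀ᶠ y in 𝓝 xp, Wt y ≤ M t (y 2) := by
      have h := hc'.eventually hM
      filter_upwards [h] with y hy
      simpa [hWt] using hy
    have h2 : ∀ᶠ y in 𝓝[{y : EuclideanSpace ℝ (Fin 3) | y 2 = xp 2}] xp, Wt y ≤ Wt xp := by
      filter_upwards [nhdsWithin_le_nhds h1, self_mem_nhdsWithin] with y hy hy2
      have hy2' : y 2 = c := by rw [show y 2 = xp 2 from hy2, hxp]
      rw [hy2'] at hy
      have : Wt xp = M t c := by simpa [hWt] using hMeq
      linarith
    exact h2
  have hmin : IsLocalMinOn Wt {y : EuclideanSpace ℝ (Fin 3) | y 2 = xm 2} xm := by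
    have hc' : ContinuousAt (fun y : EuclideanSpace ℝ (Fin 3) => ((t, y) : ℝ × EuclideanSpace ℝ (Fin 3))) xm := by fun_prop
    have h1 : ∀ᶠ y in 𝓝 xm, m t (y 2) ≤ Wt y := by
      have h := hc'.eventually hm
      filter_upwards [h] with y hy
      simpa [hWt] using hy
    have h2 : ∀ᶠ y in 𝓝[{y : EuclideanSpace ℝ (Fin 3) | y 2 = xm 2}] xm, Wt xm ≤ Wt y := by
      filter_upwards [nhdsWithin_le_nhds h1, self_mem_nhdsWithin] with y hy hy2
      have hy2' : y 2 = c := by rw [show y 2 = xm 2 from hy2, hxm]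
      rw [hy2'] at hy
      have : Wt xm = m t c := by simpa [hWt] using hmeq
      linarith
    exact h2
  have h2pt := theta_twoPoint hrate hcont hmild hdiv ht hmax hmin
  -- ### ENVELOPE, time direction
  have htp : deriv (fun s => v s xp 2) t = deriv (fun s => M s c) t := by
    have hcs : ContinuousAt (fun s : ℝ => ((s, xp) : ℝ × EuclideanSpace ℝ (Fin 3))) t := by fun_prop
    have hle : ∀ᶠ s in 𝓝 t, v s xp 2 ≤ M s c := by
      have h := hcs.eventually hM
      filter_upwards [h] with s hs
      simpa [hxp] using hs
    exact deriv_eq_of_touching hle hMeq (differentiableAt_vert_time hrate hcont hmild hdiv ht xp) hMt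
  have htm : deriv (fun s => v s xm 2) t = deriv (fun s => m s c) t := by
    have hcs : ContinuousAt (fun s : ℝ => ((s, xm) : ℝ × EuclideanSpace ℝ (Fin 3))) t := by fun_prop
    have hle : ∀ᶠ s in 𝓝 t, m s c ≤ v s xm 2 := by
      have h := hcs.eventually hm
      filter_upwards [h] with s hs
      simpa [hxm] using hs
    exact (deriv_eq_of_touching hle hmeq.symm hmt (differentiableAt_vert_time hrate hcont hmild hdiv ht xm)).symm
  -- ### ENVELOPE, height direction along the vertical lines through `x⁺`, `x⁻`
  set ℓp : ℝ → ℝ := fun σ => Wt (xp + σ • e₂) with hℓp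
  set ℓm : ℝ → ℝ := fun σ => Wt (xm + σ • e₂) with hℓm
  set Mp : ℝ → ℝ := fun σ => M t (c + σ) with hMp
  set mm : ℝ → ℝ := fun σ => m t (c + σ) with hmm
  have hℓpd : ∀ σ, DifferentiableAt ℝ ℓp σ := fun σ => (hasDerivAt_comp_line hWd xp e₂ σ).differentiableAt
  have hℓmd : ∀ σ, DifferentiableAt ℝ ℓm σ := fun σ => (hasDerivAt_comp_line hWd xm e₂ σ).differentiableAt
  have hℓp1 : deriv ℓp 0 = fderiv ℝ Wt xp e₂ := by
    have h := deriv_line_eq (x := xp) hWd 0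
    simpa [hℓp, he₂] using h
  have hℓm1 : deriv ℓm 0 = fderiv ℝ Wt xm e₂ := by
    have h := deriv_line_eq (x := xm) hWd 0
    simpa [hℓm, he₂] using h
  have hℓp2 : deriv (deriv ℓp) 0 = fderiv ℝ (fun y => fderiv ℝ Wt y e₂) xp e₂ := by
    simpa [hℓp, he₂] using deriv_deriv_line_eq (x := xp) hW2
  have hℓm2 : deriv (deriv ℓm) 0 = fderiv ℝ (fun y => fderiv ℝ Wt y e₂) xm e₂ := by
    simpa [hℓm, he₂] using deriv_deriv_line_eq (x := xm) hW2
  have hℓp2d : DifferentiableAt ℝ (deriv ℓp) 0 := by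
    have h1 : deriv ℓp = fun σ => fderiv ℝ Wt (xp + σ • e₂) e₂ := funext fun σ => by
      simpa [hℓp, he₂] using deriv_line_eq (x := xp) hWd σ
    rw [h1]
    exact (hasDerivAt_comp_line (hW1c.differentiable (by norm_num)) xp e₂ 0).differentiableAt
  have hℓm2d : DifferentiableAt ℝ (deriv ℓm) 0 := by
    have h1 : deriv ℓm = fun σ => fderiv ℝ Wt (xm + σ • e₂) e₂ := funext fun σ => by
      simpa [hℓm, he₂] using deriv_line_eq (x := xm) hWd σ
    rw [h1]
    exact (hasDerivAt_comp_line (hW1c.differentiable (by norm_num)) xm e₂ 0).differentiableAt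
  have hshift : ∀ σ : ℝ, HasDerivAt (fun σ : ℝ => c + σ) 1 σ := fun σ => by
    simpa using (hasDerivAt_id σ).const_add c
  have hc0 : Tendsto (fun σ : ℝ => c + σ) (𝓝 0) (𝓝 c) := by
    have h : Continuous (fun σ : ℝ => c + σ) := by fun_prop
    simpa using h.tendsto 0
  have hMp_d : ∀ᶠ σ in 𝓝 (0 : ℝ), DifferentiableAt ℝ Mp σ := by
    filter_upwards [hc0.eventually hM1] with σ hσ
    exact hσ.comp σ (hshift σ).differentiableAt
  have hmm_d : ∀ᶠ σ in 𝓝 (0 : ℝ), DifferentiableAt ℝ mm σ := by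
    filter_upwards [hc0.eventually hm1] with σ hσ
    exact hσ.comp σ (hshift σ).differentiableAt
  have hMp1 : deriv Mp = fun σ => deriv (M t) (c + σ) := by
    funext σ; rw [hMp]; exact deriv_comp_const_add (M t) c σ
  have hmm1 : deriv mm = fun σ => deriv (m t) (c + σ) := by
    funext σ; rw [hmm]; exact deriv_comp_const_add (m t) c σ
  have hMp1' : deriv Mp 0 = deriv (M t) c := by rw [hMp1]; simp
  have hmm1' : deriv mm 0 = deriv (m t) c := by rw [hmm1]; simp
  have hMp2 : deriv (deriv Mp) 0 = deriv (deriv (M t)) c := by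
    rw [hMp1, deriv_comp_const_add (deriv (M t)) c 0, add_zero]
  have hmm2 : deriv (deriv mm) 0 = deriv (deriv (m t)) c := by
    rw [hmm1, deriv_comp_const_add (deriv (m t)) c 0, add_zero]
  have hMp0d : DifferentiableAt ℝ Mp 0 := hMp_d.self_of_nhds
  have hmm0d : DifferentiableAt ℝ mm 0 := hmm_d.self_of_nhds
  have hMp2d : DifferentiableAt ℝ (deriv Mp) 0 := by
    rw [hMp1]
    have hM2' : DifferentiableAt ℝ (deriv (M t)) (c + 0) := by rw [add_zero]; exact hM2
    have h := hM2'.comp (0 : ℝ) (hshift 0).differentiableAt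
    simpa [Function.comp_def] using h
  have hmm2d : DifferentiableAt ℝ (deriv mm) 0 := by
    rw [hmm1]
    have hm2' : DifferentiableAt ℝ (deriv (m t)) (c + 0) := by rw [add_zero]; exact hm2
    have h := hm2'.comp (0 : ℝ) (hshift 0).differentiableAt
    simpa [Function.comp_def] using h
  -- touching along the lines
  have hlineP : ContinuousAt (fun σ : ℝ => ((t, xp + σ • e₂) : ℝ × EuclideanSpace ℝ (Fin 3))) 0 := by fun_prop
  have hlineM : ContinuousAt (fun σ : ℝ => ((t, xm + σ • e₂) : ℝ × EuclideanSpace ℝ (Fin 3))) 0 := by fun_prop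
  have hle_p : ∀ᶠ σ in 𝓝 (0 : ℝ), ℓp σ ≤ Mp σ := by
    have hT : Tendsto (fun σ : ℝ => ((t, xp + σ • e₂) : ℝ × EuclideanSpace ℝ (Fin 3))) (𝓝 0) (𝓝 (t, xp)) := by
      simpa using hlineP.tendsto
    have h := hT.eventually hM
    filter_upwards [h] with σ hσ
    have e : (xp + σ • e₂) 2 = c + σ := by rw [he₂, line_apply_two, hxp]
    show Wt (xp + σ • e₂) ≤ M t (c + σ)
    have hσ' : v t (xp + σ • e₂) 2 ≤ M t ((xp + σ • e₂) 2) := hσ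
    rw [e] at hσ'
    simpa only [hWt, e] using hσ'
  have hle_m : ∀ᶠ σ in 𝓝 (0 : ℝ), mm σ ≤ ℓm σ := by
    have hT : Tendsto (fun σ : ℝ => ((t, xm + σ • e₂) : ℝ × EuclideanSpace ℝ (Fin 3))) (𝓝 0) (𝓝 (t, xm)) := by
      simpa using hlineM.tendsto
    have h := hT.eventually hm
    filter_upwards [h] with σ hσ
    have e : (xm + σ • e₂) 2 = c + σ := by rw [he₂, line_apply_two, hxm]
    show m t (c + σ) ≤ Wt (xm + σ • e₂)
    have hσ' : m t ((xm + σ • e₂) 2) ≤ v t (xm + σ • e₂) 2 := hσ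
    rw [e] at hσ'
    simpa only [hWt, e] using hσ'
  have heq_p : ℓp 0 = Mp 0 := by simpa [hℓp, hMp, hWt, hxp] using hMeq
  have heq_m : mm 0 = ℓm 0 := by simpa [hℓm, hmm, hWt, hxm] using hmeq.symm
  -- first order
  have hzp : fderiv ℝ Wt xp e₂ = deriv (M t) c := by
    rw [← hℓp1, ← hMp1']; exact deriv_eq_of_touching hle_p heq_p (hℓpd 0) hMp0d
  have hzm : fderiv ℝ Wt xm e₂ = deriv (m t) c := by
    rw [← hℓm1, ← hmm1']; exact (deriv_eq_of_touching hle_m heq_m hmm0d (hℓmd 0)).symm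
  -- second order
  have hzzp : fderiv ℝ (fun y => fderiv ℝ Wt y e₂) xp e₂ ≤ deriv (deriv (M t)) c := by
    rw [← hℓp2, ← hMp2]
    exact deriv_deriv_le_of_touching hle_p heq_p (Eventually.of_forall hℓpd) hMp_d hℓp2d hMp2d
  have hzzm : deriv (deriv (m t)) c ≤ fderiv ℝ (fun y => fderiv ℝ Wt y e₂) xm e₂ := by
    rw [← hℓm2, ← hmm2]
    exact deriv_deriv_le_of_touching hle_m heq_m hmm_d (Eventually.of_forall hℓmd) hmm2d hℓm2d
  simp only [hWt, he₂] at hzp hzm hzzp hzzm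
  rw [htp, htm, hzp, hzm] at h2pt
  linarith [h2pt, hzzp, hzzm]

end Class

/-- **(OSC_θ) — THE DIVERGENCE FORM** (pure one-variable algebra).  At a fixed time let `Θ⁺, Θ⁻ : ℝ → ℝ` (plane sup / inf of `v₂` as
functions of the height) be `C²`, `Mt, mt` their time derivatives at height `c`, and `Δf` the residual difference `f₂(x⁺) − f₂(x⁻)`.  If
(SUB_θ) − (SUP_θ) holds at `c` in the form of `theta_osc_sub_sup` (with `v₂(x±) = Θ±(c)`), then with `D := Θ⁺ − Θ⁻` (plane oscillation of
`v₂`) and `S := Θ⁺ + Θ⁻`:  `(Mt − mt) + ½(S·D)′(c) − D″(c) ≤ Δf` — the transport terms are the divergence `½(S·D)′`. -/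
theorem theta_osc_divergence_form {Θp Θm : ℝ → ℝ} (hΘp : ContDiff ℝ 2 Θp) (hΘm : ContDiff ℝ 2 Θm) {c Mt mt Δf : ℝ}
    (hsub : (Mt + Θp c * deriv Θp c - deriv (deriv Θp) c) - (mt + Θm c * deriv Θm c - deriv (deriv Θm) c) ≤ Δf) :
    (Mt - mt) + (1 / 2) * deriv (fun z => (Θp z + Θm z) * (Θp z - Θm z)) c
      - deriv (deriv fun z => Θp z - Θm z) c ≤ Δf := by
  have hpd : Differentiable ℝ Θp := hΘp.differentiable (by norm_num)
  have hmd : Differentiable ℝ Θm := hΘm.differentiable (by norm_num)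
  have hp' : Differentiable ℝ (deriv Θp) := differentiable_deriv_of_contDiff_two hΘp
  have hm' : Differentiable ℝ (deriv Θm) := differentiable_deriv_of_contDiff_two hΘm
  have hS : DifferentiableAt ℝ (fun z => Θp z + Θm z) c := (hpd c).add (hmd c)
  have hD : DifferentiableAt ℝ (fun z => Θp z - Θm z) c := (hpd c).sub (hmd c)
  have dSD : deriv (fun z => (Θp z + Θm z) * (Θp z - Θm z)) c =
      (deriv Θp c + deriv Θm c) * (Θp c - Θm c) + (Θp c + Θm c) * (deriv Θp c - deriv Θm c) := by
    rw [deriv_fun_mul hS hD, deriv_fun_add (hpd c) (hmd c), deriv_fun_sub (hpd c) (hmd c)]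
  have dD : deriv (fun z => Θp z - Θm z) = fun z => deriv Θp z - deriv Θm z :=
    funext fun z => deriv_fun_sub (hpd z) (hmd z)
  have ddD : deriv (deriv fun z => Θp z - Θm z) c = deriv (deriv Θp) c - deriv (deriv Θm) c := by
    rw [dD, deriv_fun_sub (hp' c) (hm' c)]
  rw [dSD, ddD]
  nlinarith [hsub]

end Summit.NavierStokesRegularity.NavierStokesRegularity.Theorems.PoloidalWindowDoorLrcModEntirePlaneOscillationTheta
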